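import Summits.BirchSwinnertonDyer.Rank1Residual.X11b.KolyvaginH37Bridge
import HarnessLib

/-!
# Route `ErratumRoadFive`, crux `ShimuraKolyvaginOrderBoundInertFromFive` (item
# stmt-BirchSwinnertonDyer-19718) — CARRIER PORT K2: the `h37` label of the abstract telescope from the
# PRINTED trace ∕ congruence primitives of a family of CM points, ANCHOR-FREE

Cell `bsd-stepL`, seat `bsd-stepL-shim-p1` (prover g8), HELPER for the crux
`Summit.BirchSwinnertonDyer.BirchSwinnertonDyer.Theses.ErratumRoadFive.ShimuraKolyvaginOrderBoundInertFromFive`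
(`--supports stmt-BirchSwinnertonDyer-19718 --as helper`; plan g29 RULING 2/3 (A) + 4 (A): the carrier (α) is this
seat's target and the road that eventually un-holds the aside `ShimuraHeegnerEulerSystemInertPrinted`; design memo
HOME/shim/CARRIER-PORT-19718.md, file K2; sequel of K1 `…InertCarrierLevelData` (p487239)).

## What

x11b3-p8's bridge `KolyvaginH37Bridge.h37_of_traceRelation_of_congruence` produces the `h37` binder of the `h44`
END (McCallum Prop. 4.4 at `λ ∣ m`; for the Shimura line consumed by p475855
`h44_of_prop37_on_of_conductorNorm`) from CONCRETE `KolyvaginHeegnerData` — the `X₀(N)` container, EMPTY on the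
Shimura locus — using the tree's DISCHARGED trace relation for `X₀(N)` (`HeegnerTrace.*`) and the labelled
congruence (γ). THIS FILE is the same bridge for a BARE family of points `y(m) ∈ E(K[m])` (`m ∣ n`) with
transversals `S_m`, maps `j_m : E(K[m]) → E(K̄)` and the two Euler-system relations as LABELS:
* (TR) `∑_{i ≤ ℓ} σ_ℓ^i y(m) = a_ℓ · y(m/ℓ)↑` in `E(K[m])` (`a_ℓ = W.frobeniusTrace ℓ`) — Gross 1991 Prop. 3.7 (1);
  for `X_{N⁺,N⁻}`: Bertolini–Darmon 1996 §2.4, Nekovář 2007 (4.8);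
* (CONG) `red(γ y(m)) = Frob · red(γ y(m/ℓ)↑)` — Gross Prop. 3.7 (2); Nekovář 2007 (4.9);
* (COH) the inter-level coherence of the derived points in `E(K̄)` (supplied by K1's tower:
  `exists_ringClassLevelData`, clause (β1));
and abstract Euler data tied to them by the bridge's dictionary (`iA`, `hjA`, `hyA`, `hσA`, `hfS`, …).

* **`h37_of_labels`** — the `h37` binder VERBATIM (guard `m ∣ n`), `p`-free except in the unused
  Kolyvagin-prime hypothesis (any level `M'`).

HONEST FRAMING: THEOREMS ONLY; (TR) ∕ (CONG) are HYPOTHESES (the printed primitives — they are what the typer's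
aside text states); nothing about `X_{N⁺,N⁻}` is constructed; item 19718 and S1 ∕ S2 stay OPEN; BSD is not proved
by any of this; no census number moves. [cite: GrossLMS1991, §3 Prop. 3.7 (1)(2), §4 (4.1)] [cite: McCallumLMS1991,
§4 Prop. 4.4] [cite: BertoliniDarmon1996, §2.4–2.5] [cite: Nekovar2007, (4.8), (4.9)]
presearch: n/a beyond CARRIER-PORT-19718.md (primitives located: S1S2-ROAD-19718.md §6; SHIM3A-MEMO §2);
`lean search 'h37_of_labels'` → none.
-/

noncomputable section

open scoped Classical

set_option linter.dupNamespace false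

namespace Summit.BirchSwinnertonDyer.BirchSwinnertonDyer.Theorems

open WeierstrassCurve Field NumberField IsDedekindDomain Finset
  Literature.NumberTheory.EllipticCurves Literature.NumberTheory.GaloisRepresentations
  Literature.NumberTheory.EllipticCurves.KolyvaginCocycle
  Literature.NumberTheory.EllipticCurves.KolyvaginEuler
  Literature.NumberTheory.EllipticCurves.RingClassField
  Summit.BirchSwinnertonDyer.Rank1Residual.X11b
  Summit.BirchSwinnertonDyer.Rank1Residual.X11b.KolyvaginTowerLift
  Summit.BirchSwinnertonDyer.Rank1Residual.X11b.KolyvaginH37Bridge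

variable {K : Type} [Field K] [NumberField K] {N : ℕ} {W : WeierstrassCurve ℚ}

/-- **The `h37` bridge from LABELS, anchor-free.** `K` imaginary quadratic, `ι : K → ℂ`, `E = W/ℚ` elliptic, a top
level `n`; at every `m ∣ n`: a CM point `y(m) ∈ E(K[m])`, generators `σc m : ℕ → Aut(K[m])`, a transversal `Sc m`
of `Gal(K[m]/K[1])` in `𝒢_m`, an additive `jc m : E(K[m]) → E(K̄)`; LABELS (COH) (the level-`m` machine of index
`m/ℓ` run on `y(m/ℓ)↑` has the same image in `E(K̄)` as the level-`m/ℓ` derived point — K1), (TR) (trace relation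
with `a_ℓ = W.frobeniusTrace ℓ`), (CONG) (congruence in `geomReduction` currency); and ABSTRACT Euler data
(`𝒢 m ↷ A₀ m`, `σ`, `L`, `H`, `f`, `y`, `j`, injective `ρ`) with the dictionary `iA`, `hiA`, `hjA`, `hyA`, `hσA`,
`hL`, `hfsec`, `hfS`, `hHρ`, `h𝒢ρ`, `hSρ`. Conclusion: the `h37` binder of `h44_of_prop37_on_of_conductorNorm`
(p475855) at every `m ∣ n` — (α) `ℓ ∈ L m`; with `y' = (iA m)⁻¹ (y(m/ℓ)↑)`: (β1) from (COH) by G1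
(`map_kolyvaginPoint_eq_derivedPoint`), (β2) from (TR) transferred along `iA m`, (γ) from (CONG). Proof = x11b3's
`h37_of_traceRelation_of_congruence` with the container's fields replaced by the bare data and the `X₀(N)` trace
THEOREM replaced by the label (TR). [cite: GrossLMS1991, Prop. 3.7 (1)(2), §4 (4.1)] [cite: McCallumLMS1991, Prop. 4.4]
[cite: BertoliniDarmon1996, §2.4] [cite: Nekovar2007, (4.8), (4.9)] -/
theorem h37_of_labels (hK : IsImaginaryQuadratic K) (ι : K →+* ℂ) [NeZero N] [W.IsElliptic]
    [W.IsGloballyMinimal] (p M' : ℕ) {n : ℕ}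
    (yc : (m : ℕ) → m ∣ n → (W.baseChange (ringClassField K ι m)).toAffine.Point)
    (σc : (m : ℕ) → m ∣ n → ℕ → (ringClassField K ι m ≃ₐ[ℚ] ringClassField K ι m))
    (Sc : (m : ℕ) → m ∣ n → Finset (ringClassField K ι m ≃ₐ[ℚ] ringClassField K ι m))
    (hScsub : ∀ (m : ℕ) (hm : m ∣ n), ∀ s ∈ Sc m hm, s ∈ ringClassGal ι m)
    (hSctr : ∀ (m : ℕ) (hm : m ∣ n), ∀ g ∈ ringClassGal ι m, ∃! s, s ∈ Sc m hm ∧ g⁻¹ * s ∈ ringClassGalOver ι m 1)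
    (jc : (m : ℕ) → m ∣ n →
      ((W.baseChange (ringClassField K ι m)).toAffine.Point →+ geomPoints (W.baseChange K)))
    (hcoh : ∀ (m : ℕ) (hm : m ∣ n) (ℓ : ℕ) (hℓ : ℓ ∈ m.primeFactors)
      (hle : ringClassField K ι (m / ℓ) ≤ ringClassField K ι m),
      letI : Algebra K ℂ := ι.toAlgebra
      jc m hm
          (KolyvaginOperator.derivedPoint (pointGalHom W (ringClassField K ι m)) (σc m hm) (m / ℓ) (Sc m hm)
            (WeierstrassCurve.Affine.Point.map (W' := W)
              ((RingClassField.inclusion ι hle).restrictScalars ℚ)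
              (yc (m / ℓ) ((Nat.div_dvd_of_dvd (Nat.dvd_of_mem_primeFactors hℓ)).trans hm)))) =
        jc (m / ℓ) ((Nat.div_dvd_of_dvd (Nat.dvd_of_mem_primeFactors hℓ)).trans hm)
          (KolyvaginOperator.derivedPoint (pointGalHom W (ringClassField K ι (m / ℓ)))
            (σc (m / ℓ) ((Nat.div_dvd_of_dvd (Nat.dvd_of_mem_primeFactors hℓ)).trans hm)) (m / ℓ)
            (Sc (m / ℓ) ((Nat.div_dvd_of_dvd (Nat.dvd_of_mem_primeFactors hℓ)).trans hm))
            (yc (m / ℓ) ((Nat.div_dvd_of_dvd (Nat.dvd_of_mem_primeFactors hℓ)).trans hm))))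
    (htr : ∀ (m : ℕ) (hm : m ∣ n) (ℓ : ℕ) (hℓ : ℓ ∈ m.primeFactors)
      (hle : ringClassField K ι (m / ℓ) ≤ ringClassField K ι m),
      letI : Algebra K ℂ := ι.toAlgebra
      ∑ i ∈ Finset.range (ℓ + 1), pointGalHom W (ringClassField K ι m) (σc m hm ℓ ^ i) (yc m hm) =
        W.frobeniusTrace ℓ • WeierstrassCurve.Affine.Point.map (W' := W)
          ((RingClassField.inclusion ι hle).restrictScalars ℚ)
          (yc (m / ℓ) ((Nat.div_dvd_of_dvd (Nat.dvd_of_mem_primeFactors hℓ)).trans hm)))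
    (hγ : ∀ (m : ℕ) (hm : m ∣ n) (ℓ : ℕ) (hℓ : ℓ ∈ m.primeFactors) [Fact ℓ.Prime]
      (hΔ : ¬ (ℓ : ℤ) ∣ minimalDiscriminantInt W) (φ₀ : absoluteGaloisGroup (ZMod ℓ)),
      (∀ x : AlgebraicClosure (ZMod ℓ), φ₀ • x = x ^ ℓ) →
      ∀ (hle : ringClassField K ι (m / ℓ) ≤ ringClassField K ι m)
        (γ : ringClassField K ι m ≃ₐ[ℚ] ringClassField K ι m), γ ∈ ringClassGal ι m →
        letI : Algebra K ℂ := ι.toAlgebra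
        geomReduction hΔ ((RatClosure.pointsEquiv (K := K) W).symm
            (jc m hm (pointGalHom W (ringClassField K ι m) γ (yc m hm)))) =
          φ₀ • geomReduction hΔ ((RatClosure.pointsEquiv (K := K) W).symm
            (jc m hm (pointGalHom W (ringClassField K ι m) γ
              (WeierstrassCurve.Affine.Point.map (W' := W)
                ((RingClassField.inclusion ι hle).restrictScalars ℚ)
                (yc (m / ℓ) ((Nat.div_dvd_of_dvd (Nat.dvd_of_mem_primeFactors hℓ)).trans hm)))))))
    {𝒢 : ℕ → Type*} [∀ m, CommGroup (𝒢 m)] {A₀ : ℕ → Type*} [∀ m, AddCommGroup (A₀ m)]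
    [∀ m, DistribMulAction (𝒢 m) (A₀ m)]
    (σ : ∀ m, ℕ → 𝒢 m) (L : ℕ → Finset ℕ) (H : ∀ m, Subgroup (𝒢 m))
    [∀ m, Fintype (𝒢 m ⧸ H m)] (f : ∀ m, 𝒢 m ⧸ H m → 𝒢 m) (y : ∀ m, A₀ m)
    (j : ∀ m, A₀ m →+ geomPoints (W.baseChange K))
    (ρ : ∀ m, 𝒢 m →* (ringClassField K ι m ≃ₐ[ℚ] ringClassField K ι m))
    (hρ : ∀ m, Function.Injective (ρ m))
    (iA : ∀ m, A₀ m ≃+ (W.baseChange (ringClassField K ι m)).toAffine.Point)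
    (hiA : ∀ (m : ℕ), m ∣ n → ∀ (g : 𝒢 m) (a : A₀ m),
      iA m (g • a) = pointGalHom W (ringClassField K ι m) (ρ m g) (iA m a))
    (hjA : ∀ (m : ℕ) (hm : m ∣ n) (a : A₀ m), j m a = jc m hm (iA m a))
    (hyA : ∀ (m : ℕ) (hm : m ∣ n), iA m (y m) = yc m hm)
    (hσA : ∀ (m : ℕ) (hm : m ∣ n), ∀ q ∈ m.primeFactors, ρ m (σ m q) = σc m hm q)
    (hL : ∀ m : ℕ, m ∣ n → L m = m.primeFactors)
    (hfsec : ∀ m : ℕ, m ∣ n → ∀ c : 𝒢 m ⧸ H m, (f m c : 𝒢 m ⧸ H m) = c)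
    (hfS : ∀ (m : ℕ) (hm : m ∣ n) (c : 𝒢 m ⧸ H m), ρ m (f m c) ∈ Sc m hm)
    (hHρ : ∀ m : ℕ, m ∣ n → ∀ h ∈ H m, ρ m h ∈ ringClassGalOver ι m 1)
    (h𝒢ρ : ∀ m : ℕ, m ∣ n → ∀ g : 𝒢 m, ρ m g ∈ ringClassGal ι m)
    (hSρ : ∀ (m : ℕ) (hm : m ∣ n),
      (Sc m hm : Set (ringClassField K ι m ≃ₐ[ℚ] ringClassField K ι m)) ⊆ Set.range (ρ m)) :
    ∀ m : ℕ, m ∣ n → Squarefree m →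
      (∀ q ∈ m.primeFactors, IsKolyvaginPrime N W K p q ∧ FrobEqFrobInfty W K (p ^ M') q) →
      ∀ ℓ : ℕ, ℓ.Prime → ℓ ∣ m →
      ℓ ∈ L m ∧ ∃ y' : A₀ m,
        j m (kolyvaginPoint (σ m) ((L m).erase ℓ) (f m) y') =
          j (m / ℓ) (kolyvaginPoint (σ (m / ℓ)) (L (m / ℓ)) (f (m / ℓ)) (y (m / ℓ))) ∧
        grAct (A₀ m) (traceElt (σ m ℓ) ℓ) (y m) = W.frobeniusTrace ℓ • y' ∧
        ∀ [Fact ℓ.Prime] (hΔ : ¬ (ℓ : ℤ) ∣ minimalDiscriminantInt W)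
          (φ₀ : absoluteGaloisGroup (ZMod ℓ)), (∀ x : AlgebraicClosure (ZMod ℓ), φ₀ • x = x ^ ℓ) →
          ∀ γ : 𝒢 m, geomReduction hΔ ((RatClosure.pointsEquiv (K := K) W).symm (j m (γ • y m))) =
            φ₀ • geomReduction hΔ ((RatClosure.pointsEquiv (K := K) W).symm (j m (γ • y'))) := by
  -- adapted from x11b3-p8's `KolyvaginH37Bridge.h37_of_traceRelation_of_congruence`
  intro m hm hmsq _hkol ℓ hℓp hℓm
  letI : Algebra K ℂ := ι.toAlgebra
  have hm0 : m ≠ 0 := Squarefree.ne_zero hmsq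
  have hℓmem : ℓ ∈ m.primeFactors := Nat.mem_primeFactors.mpr ⟨hℓp, hℓm, hm0⟩
  have hm' : m / ℓ ∣ n := (Nat.div_dvd_of_dvd hℓm).trans hm
  have hm'sq : Squarefree (m / ℓ) := hmsq.squarefree_of_dvd (Nat.div_dvd_of_dvd hℓm)
  -- `K[m/ℓ] ≤ K[m]`
  have hle : ringClassField K ι (m / ℓ) ≤ ringClassField K ι m :=
    ringClassField_mono hK ι (Nat.div_dvd_of_dvd hℓm) hm0
  -- the bijections `𝒢 k ⧸ H k → S_k`
  have hbij : ∀ (k : ℕ) (hk : k ∣ n),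
      Set.BijOn (fun c : 𝒢 k ⧸ H k ↦ ρ k (f k c)) Set.univ
        (Sc k hk : Set (ringClassField K ι k ≃ₐ[ℚ] ringClassField K ι k)) :=
    fun k hk ↦ bijOn_of_section_of_transversal (ρ k) (hρ k) (hHρ k hk) (hScsub k hk)
      (hSρ k hk) (hSctr k hk) (f k) (hfsec k hk) (hfS k hk)
  -- the witness: `y' = y(m/ℓ)↑` read in `A₀ m`
  set y₀ : (W.baseChange (ringClassField K ι m)).toAffine.Point :=
    WeierstrassCurve.Affine.Point.map (W' := W)
      ((RingClassField.inclusion ι hle).restrictScalars ℚ) (yc (m / ℓ) hm') with hy₀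
  refine ⟨by rw [hL m hm]; exact hℓmem, (iA m).symm y₀, ?_, ?_, ?_⟩
  · -- (β1): G1 at both levels + the coherence label (COH)
    rw [hjA m hm, hjA (m / ℓ) hm', hL m hm, hL (m / ℓ) hm',
      ← primeFactors_div_eq_erase hmsq hℓp hℓm,
      map_kolyvaginPoint_eq_derivedPoint (pointGalHom W (ringClassField K ι m)) (ρ m) (iA m)
        (hiA m hm) hm'sq
        (fun q hq ↦ hσA m hm q (Nat.primeFactors_mono (Nat.div_dvd_of_dvd hℓm) hm0 hq))
        (f m) (hbij m hm),
      map_kolyvaginPoint_eq_derivedPoint (pointGalHom W (ringClassField K ι (m / ℓ))) (ρ (m / ℓ))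
        (iA (m / ℓ)) (hiA (m / ℓ) hm') hm'sq (hσA (m / ℓ) hm') (f (m / ℓ)) (hbij (m / ℓ) hm'),
      hyA (m / ℓ) hm', AddEquiv.apply_symm_apply]
    exact hcoh m hm ℓ hℓmem hle
  · -- (β2): the trace label (TR), transferred to `A₀ m` along `iA m`
    apply (iA m).injective
    rw [grAct_traceElt, map_sum, map_zsmul, AddEquiv.apply_symm_apply, hy₀]
    simp_rw [hiA m hm, map_pow (ρ m), hσA m hm ℓ hℓmem, hyA m hm]
    exact htr m hm ℓ hℓmem hle
  · -- (γ): the congruence label (CONG), read back through the dictionary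
    intro _ hΔ φ₀ hφ₀ γ
    rw [hjA m hm, hjA m hm, hiA m hm, hiA m hm, hyA m hm, AddEquiv.apply_symm_apply, hy₀]
    exact hγ m hm ℓ hℓmem hΔ φ₀ hφ₀ hle (ρ m γ) (h𝒢ρ m hm γ)

end Summit.BirchSwinnertonDyer.BirchSwinnertonDyer.Theorems

end
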